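import Summits.QuantumFields.YangMills.Theorems.BalabanUVNodesN12AtRecord13SepCoPHSockets
import Summits.QuantumFields.YangMills.Theorems.BalabanUVNodesN12AtRecord13TermPinnedZres

/-!
# BalabanUVNodes ∕ N12 — THE K1⁷ v5 RUNG BODY WITH THE [IV] LAYER PINNED AT THE LETTERS OF RECORD, AT THE v1.7 `CoPH` RECORD: the `∃ λ` of `NodesAtSomeRecord13PWS` (under T₇) WITNESSED BY
# `λᴾ := (λ.pinRPrime₁₃ θL).pinD189ΛH ν A₁ M g σᶻ s N p₁` — dag-n12-e's R′-of-record pin (module 14, the (1.100) data = `rPrimeDataOfSel` of the run's pre-𝐑 representation) and the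
# `Λ`-pinned (1.89) situation over the `Z″`-of-record ∕ side ∕ `χ(Ω^{∼4})` ∕ `Ω″`-pinned family `σᶻ` (modules 15–19) — so that N12's per-run displays of 12T-H (the (1.100) pin equation, (1.80), (1.89))
# are REPLACED by this seat's 12P ★★ row's LOCATED INPUTS (p516715 `…N12AtRecord13TermPinnedZres`; θ-level, NOT re-issued at v1.7): the residual NUMBERS of the base situation + print's two p.200
# conditions, the levels, the (2.8a) flow input, `Λ ≠ ∅`, the four ℍ-leaves + (1.80) at the pinned setting `D P`, the run's window + the β-sign leaf; live-mass (NODE 00), Prop. 1 at `λ.LF P` and the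
# selector bound stay (T₇ twin of this seat's 12W `…N12AtRecord13SepCoPRSocketsPinned` p537827; sequel of 12T-H `…N12AtRecord13SepCoPHSockets` over its §0 S-bound generic-W₀ engine at v1.7;
# Track A, DAG node N12 = [B15, Balaban1989LargeFieldI] CMP **122** (1989) 175–202; cluster K1: K1⁷ `StabilityBAtRecordR13SepCoPH` (rev 24, PRESS WORD №190; the ⁶ key stmt-QuantumFields-20507 STANDS
# until «KEY-24 SERVED»); seat `pub-ymgap-dag-n12-d` g12 (R134 s2 «knit at the record»), 2026-08-27; count-neutral, NOT a discharge)

HONEST FRAMING.  Count-neutral kernel COMPOSITION BY NAME: 12T-H §0∕§1's engine and packaging with N12's `h12` below the torus supplied by 12P's ★★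
`b15Leaf_WOfRecord₁₃_pinAllΛΩχZ_N0_liveRepin₁₃_of_massLive_of_hasResiduals_of_flow_of_betaLowerH` at the run's own `hk : λ.kSel P < P.K` (its per-run hypotheses displayed here as `∀ P, λ.kSel P < P.K → …`
families; the pinned setting abbreviated `D P` with `hD : D P = λᴾ.D189 P`), the `K = 0` runs by the mixed W-pin's `hWdeg`, N13 by dag-n11-e's v1.7 `laws₁₃CoPH_liveRepin₁₃_of_hasResiduals` at the H-extension `⟨⟨Θ.liveRepin₁₃, Zr⟩, Zh, Phih⟩` (all three slots free; the door-cured pin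
`Stage13HParams.ofHistoryBlind (Stage13RParams.ofCured (Θ.liveRepin₁₃))` IS such an extension by `rfl`), the v5 pin by `hsel` + `hW` + `hup` (`λᴾ.kSel = λ.kSel`, `rfl`).  N12 READS NO 𝐓-WEIGHT: every N12 object (`WOfRecord₁₃`, `reprTOfRecord₁₃`, `gOfRecord₁₃`, 12P's pins) sits at
`θ.toStage13Params = Θ.liveRepin₁₃` (`rfl`).  WHAT N12 COSTS INSIDE THE K1⁷ RUNG AT THE LAYER OF RECORD (= this file's N12 binders, nothing hidden; unchanged from v1.6): live-mass of the LIVE pre-𝐑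
terms (NODE 00) · `Prop1Printed (λ.LF P)` (dag-n12-c's intrinsic letters, 12Q′ — the LF pin rides separately; `…_ofNearValue` endpoints p538229∕successor) · `hlog ∕ hNN ∕ hNk` (levels) · `hβ0 hβ hL₀
hL₀L hB hδ hN₀ hMl` (the base situation's residual numbers + print's p.200 conditions) · `hε0 hε1 hflow` (flow inputs, (2.8a)) · `hI` + `hb hlow hγ1` (the run's window + β-sign leaf — K1's own
letters) · `hΛ` (`Λ ≠ ∅`) · `L91h L95 L91 L97 L80` (the four ℍ-leaves + (1.80): N07's objects) · `hM₂ hM` · `hsel` · `hWdeg` (K = 0 only).  ONE-WAY (FILE 27 §H1): the door-cured pin is history-BLIND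
— the image of the K0⁶ → K0⁷ witness road, not print's history-reading weights; §1 is the socket for those.  Nothing of Bałaban's is asserted; N12 is NOT discharged; no node is discharged; counts
unmoved (Track A discharged 5∕28); a re-key is not progress.  ONE finite four-torus programme at fixed `ε = L^{-K}` — nothing continuum ∕ ℝ⁴ ∕ OS ∕ mass gap ∕ Clay.

Sources: [Balaban1989LargeFieldI] (0.2)–(0.6) p.176, (1.2) p.178, (1.10)–(1.11) p.179, (1.73) p.192, Prop. 1 (1.78) p.194, (1.80) p.195, (1.89) p.198, (1.91)–(1.102) pp.199–201; [Balaban1988Convergent]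
(1.11) p.248, (2.1)–(2.8) pp.254–256, (2.17) p.257, (2.20)–(2.22) p.258, (3.16)–(3.25) pp.268–270; [Balaban1987RG1] (0.20) p.256; [Balaban1989LargeFieldII] Thm 1 + (0.1) pp.355–356, p.391;
[Balaban1985RegularSpaces] Thm 8 p.101 (surviving form).
-/

noncomputable section

open MeasureTheory
open scoped Matrix.Norms.L2Operator

namespace Summit.QuantumFields.YangMills.BalabanUVNodes.N12AtRecord13SepCoPHSocketsPinned

open Literature.MathematicalPhysics.QuantumFieldTheory.Balaban1983to89
open Literature.MathematicalPhysics.QuantumFieldTheory.Balaban1983to89.T4Continuum (T4Family)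
open Literature.MathematicalPhysics.QuantumFieldTheory.Balaban1983to89.DagBinding
open Literature.MathematicalPhysics.QuantumFieldTheory.Balaban1983to89.Node00
open FlowStep (BetaLowerH BetaUpperH)
open FlowStepRuns (genFlow)
open B15Claim189Assembly (Setting189 new189 chiPP dom half)
open B15 (Prop1Printed Ineq180)
open B15.BasicStep (Claim189)
open B15.PrelimIntegrations (Ineq191 Ineq195)
open B15Chi124DetSets (E124)
open B15DeterminingSets (MSField)
open B14DomainGeom (Pt)
open B8Eq17ClassAkV1 (plaqsOf)
open GaugeGroup (dist1)
open GaugeField (plaqHol)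
open B15RPrime1100OfRep (rPrimeDataOfSel)
open B15Claim189PrintedConditions (omegaOfChain)
open B15Claim189PinsOfHistory (sitOfHist N0OfRecord₁₃ D189OfHist)
open B15Claim189LambdaPin (enlD)
open B16RLeafRecord13LiveCoPH (laws₁₃CoPH_liveRepin₁₃_of_hasResiduals)
open Summit.QuantumFields.YangMills.BalabanUVNodes.N12AtRecord13SepCoPHSockets (nodes₁₃CoPH_upS_fourPinW₀_pointed recordS₁₃SepCoPH_of_upS_pinB10YZW₀)

variable {N : ℕ} [NeZero N] {F : T4Family}

section Live
variable (Θ : Stage13Params F N) (Zr : (q : B12.RunParams) → TkResidualW F N (FluctV N) q.K)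
  (Zh : (q : B12.RunParams) → ℕ → (ℕ → Set (Site (F.P q.K) 0)) → (ℕ → Set (Site (F.P q.K) 0)) → TkResidualW F N (FluctV N) q.K)
  (Phih : (q : B12.RunParams) → ℕ → (ℕ → Set (Site (F.P q.K) 0)) → (ℕ → Set (Site (F.P q.K) 0)) → (ℕ → Plaq (F.P q.K) 0 → ℝ)) (lam : ResidW F N) (σ : ∀ P : B12.RunParams, Sit189 F N P.K)
  (s : ∀ P : B12.RunParams, SeqOfRecord F Θ.ν Θ.τ9.M (gOfRecord₁₃ F N (Θ.liveRepin₁₃ F N) P) P.K (lam.kSel P + 1)) (Nm : B12.RunParams → ℕ) (p₁ : ℕ)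
  (Mstar : ℕ) (ops : OpsY N (Θ.liveRepin₁₃ F N).toStage3Params Mstar) (ζ : ResidZ F N) (W₀ : B12.RunParams → PrintedCarriers15) (w : WorldP)

/-- **★★ THE K1⁷ v5 RUNG BODY AT THE H-EXTENSION `⟨⟨Θ.liveRepin₁₃, Zr⟩, Zh, Phih⟩`, THE [IV] LAYER PINNED AT THE LETTERS OF RECORD** — 12T-H §1 with `λ := λᴾ(lam, σ, s, N, p₁)` and N12's row below the torus by 12P's ★★ `b15Leaf_WOfRecord₁₃_pinAllΛΩχZ_N0_liveRepin₁₃_of_massLive_of_hasResiduals_of_flow_of_betaLowerH` from its located per-run inputs; `hZh`, `hsel`, `hWdeg` displayed; N13 by dag-n11-e.  At `N := 2` the conclusion is `NodesAtSomeRecord13PWS F`'s body with `RecordS` unfolded, its `∃ λ` witnessed by the LAYER OF RECORD.  COMPOSITE: nothing discharged as a node. [cite: Balaban1989LargeFieldII, Thm 1 p.355, (0.1) pp.355–356, p.387, p.391; Balaban1989LargeFieldI, (0.1) p.175, (0.2)–(0.6) p.176, p.177 (i)–(ii), Prop. 1 (1.78) p.194, (1.80) p.195, (1.89) p.198, (1.99)–(1.102)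 pp.200–201; Balaban1988Convergent, (1.11) p.248, p.244, Thm 1 p.262, (2.18) p.257, (3.16)–(3.25) pp.268–270; Balaban1985RegularSpaces, Lemma 1 – Thm 8 pp.79–101, Thm 8 (1.146) p.101 (surviving form); Balaban1985UV3, Thm 1 p.257, Thm 2 p.272; Balaban1985BackgroundPropagators, Thm 3.1 p.397; Balaban1985Variational, Thm 1 p.279; Balaban1987RG1, Thm 1 p.259, Lemma 4 p.280; Balaban1988RG2Cluster, Lemmas 1–3 pp.9–20 (bookkeeping)] -/
theorem nodesAtSomeRecordS₁₃SepCoPH_of_upS_fourPinW₀_pinnedΛΩχZ_liveRepin₁₃H_of_massLive_of_hasResiduals (hres : Θ.HasResidualsOfRecord F N)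
    (hP : (⟨⟨Θ.liveRepin₁₃ F N, Zr⟩, Zh, Phih⟩ : Stage13HParams F N).Provisos₁₃SepCoPH F N) (hθ : Θ.Admissible F N) (hZh : (⟨⟨Θ.liveRepin₁₃ F N, Zr⟩, Zh, Phih⟩ : Stage13HParams F N).ZhUnity F N)
    (hκ : 0 ≤ Θ.s2.lf.κ) (hE₀ : 0 ≤ Θ.s2.lf.E₀) (hB₀ : 0 ≤ Θ.s2.lf.B₀)
    -- the mixed W-pin AT THE LAYER OF RECORD λᴾ: below the torus `W₀ P` IS the bundle of record at λᴾ; elsewhere the closer's leaf-carrying `W₀ P`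
    (hW : ∀ P : B12.RunParams, lam.kSel P < P.K → W₀ P = WOfRecord₁₃ F N (Θ.liveRepin₁₃ F N)
      ((lam.pinRPrime₁₃ (Θ.liveRepin₁₃ F N)).pinD189ΛH (Θ.liveRepin₁₃ F N).ν (Θ.liveRepin₁₃ F N).A₁ (Θ.liveRepin₁₃ F N).τ9.M (gOfRecord₁₃ F N (Θ.liveRepin₁₃ F N))
        (fun P => (((((σ P).pinZres Θ.ν Θ.τ9.M (gOfRecord₁₃ F N (Θ.liveRepin₁₃ F N) P) (s P) (N0OfRecord₁₃ (Θ.liveRepin₁₃ F N) P (lam.kSel P + 1))).pinSides Θ.ν (gOfRecord₁₃ F N (Θ.liveRepin₁₃ F N) P) (lam.kSel P + 1 - Nm P) (lam.kSel P + 1)).pinXΩ4 (s P) (enlD F Θ.ν Θ.τ9.M P (gOfRecord₁₃ F N (Θ.liveRepin₁₃ F N) P))).pinOmegaPP (s P) (Nm P) (enlD F Θ.ν Θ.τ9.M P (gOfRecord₁₃ F N (Θ.liveRepin₁₃ F N) P)))) s Nm p₁) P)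
    (hWdeg : ∀ P : B12.RunParams, P.K ≤ lam.kSel P → B15Leaf (W₀ P))
    (hC : w.C = (datumOfRecord₁₃SepCoPH F N (⟨⟨Θ.liveRepin₁₃ F N, Zr⟩, Zh, Phih⟩ : Stage13HParams F N) hP).C) (hγ : 0 < w.γ ∧ w.γ ≤ (Θ.liveRepin₁₃ F N).γ) (hL : w.L = ((Θ.liveRepin₁₃ F N).L : ℝ))
    (hup : ∀ P, w.up P = upOfRecord₅CS F N ((((((⟨⟨Θ.liveRepin₁₃ F N, Zr⟩, Zh, Phih⟩ : Stage13HParams F N).toStage5₁₃CoPH F N).pinB10 F N).pinY F N (Y9OfRecord N (Θ.liveRepin₁₃ F N).toStage3Params Mstar ops)).pinZ F N (Z11OfRecord F N ζ)).pinW F N W₀) P)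
    (h05S : ∀ P : B12.RunParams, (upOfRecord₅CS F N ((((((⟨⟨Θ.liveRepin₁₃ F N, Zr⟩, Zh, Phih⟩ : Stage13HParams F N).toStage5₁₃CoPH F N).pinB10 F N).pinY F N (Y9OfRecord N (Θ.liveRepin₁₃ F N).toStage3Params Mstar ops)).pinZ F N (Z11OfRecord F N ζ)).pinW F N W₀) P).b8)
    (h06 : B9LeafX (Y9OfRecord N (Θ.liveRepin₁₃ F N).toStage3Params Mstar ops))
    (h07 : B11Leaf (Z11OfRecord F N ζ))
    (h08 : PrintedUV3V N (Θ.liveRepin₁₃ F N).L)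
    (h09 : ∀ P : B12.RunParams, B12Sec2to5.Lemma4Printed ((Θ.liveRepin₁₃ F N).res.X P).F12 ((Θ.liveRepin₁₃ F N).res.X P).c12)
    (h09T : ∀ P : B12.RunParams, (leavesP w P).smallCouplings → (leavesP w P).smallFieldInductive)
    (h10 : ∀ P : B12.RunParams, B9LeafX (Y9OfRecord N (Θ.liveRepin₁₃ F N).toStage3Params Mstar ops) →
      (B10.Thm1PrintedCompact (((((((⟨⟨Θ.liveRepin₁₃ F N, Zr⟩, Zh, Phih⟩ : Stage13HParams F N).toStage5₁₃CoPH F N).pinB10 F N).pinY F N (Y9OfRecord N (Θ.liveRepin₁₃ F N).toStage3Params Mstar ops)).pinZ F N (Z11OfRecord F N ζ)).pinW F N W₀).res.X P).runs10 ∧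
          B10.Thm2Printed (((((((⟨⟨Θ.liveRepin₁₃ F N, Zr⟩, Zh, Phih⟩ : Stage13HParams F N).toStage5₁₃CoPH F N).pinB10 F N).pinY F N (Y9OfRecord N (Θ.liveRepin₁₃ F N).toStage3Params Mstar ops)).pinZ F N (Z11OfRecord F N ζ)).pinW F N W₀).res.X P).runs10) →
        B11Leaf (Z11OfRecord F N ζ) → B12Sec2to5.Lemma4Printed ((Θ.liveRepin₁₃ F N).res.X P).F12 ((Θ.liveRepin₁₃ F N).res.X P).c12 →
          B13.Lemma1Printed ((Θ.liveRepin₁₃ F N).res.X P).S13 ((Θ.liveRepin₁₃ F N).res.X P).c13 ∧ B13.Lemma2Printed ((Θ.liveRepin₁₃ F N).res.X P).S13 ((Θ.liveRepin₁₃ F N).res.X P).c13 ∧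
            B13.Lemma3Printed ((Θ.liveRepin₁₃ F N).res.X P).S13 ((Θ.liveRepin₁₃ F N).res.X P).c13)
    (h11 : ∀ P : B12.RunParams, (leavesP w P).b7 → (leavesP w P).b8 → (leavesP w P).b9 → (leavesP w P).b10 → (leavesP w P).b11 →
      (leavesP w P).smallCouplings → (leavesP w P).smallFieldInductive → (leavesP w P).flowControl →
        ∀ k, k < P.K → SLaw₁₃CoPH F N (⟨⟨Θ.liveRepin₁₃ F N, Zr⟩, Zh, Phih⟩ : Stage13HParams F N) P k → TLaw₁₃CoPH F N (⟨⟨Θ.liveRepin₁₃ F N, Zr⟩, Zh, Phih⟩ : Stage13HParams F N) P k)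
    (hUV : ∀ P : B12.RunParams, (genFlow (betaOfRecord₁₃ F N (Θ.liveRepin₁₃ F N)) P.g0).InInterval w.γ P.K → ∀ k, k ≤ P.K → SLaw₁₃CoPH F N (⟨⟨Θ.liveRepin₁₃ F N, Zr⟩, Zh, Phih⟩ : Stage13HParams F N) P k →
      ∀ U : GaugeField (F.P P.K) k (SU N),
        chiβOfRecord₁₃ F N (Θ.liveRepin₁₃ F N) P.K (gOfRecord₁₃ F N (Θ.liveRepin₁₃ F N) P) k U *
              Real.exp (-(1 / (gOfRecord₁₃ F N (Θ.liveRepin₁₃ F N) P k) ^ 2 * wilsonBGOfRecord F N (Θ.liveRepin₁₃ F N).εbg P k U)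
                - w.em (gOfRecord₁₃ F N (Θ.liveRepin₁₃ F N) P k) * (Fintype.card (Site (F.P P.K) k) : ℝ)) ≤ densOfRecord₁₃ F N (Θ.liveRepin₁₃ F N) P k U ∧
        densOfRecord₁₃ F N (Θ.liveRepin₁₃ F N) P k U ≤ Real.exp (w.ep (gOfRecord₁₃ F N (Θ.liveRepin₁₃ F N) P k) * (Fintype.card (Site (F.P P.K) k) : ℝ)))
    -- N12 AT THE LAYER OF RECORD: 12P's located per-run inputs, run by run, BELOW THE TORUS ONLY (`D P` abbreviates the pinned (1.89) setting `λᴾ.D189 P`)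
    (hM₂ : 0 < Θ.ν.M₂)
    (hM : 0 < Θ.τ9.M)
    (D : ∀ P : B12.RunParams, Setting189 (F.P P.K) (SU N) (MSField (F.P P.K) (SU N) × ((j : ℕ) → VecField (F.P P.K) j (EuclideanSpace ℝ (Fin (N ^ 2 - 1))))) (Pt (F.P P.K).d))
    (hD : ∀ P : B12.RunParams, D P = ((lam.pinRPrime₁₃ (Θ.liveRepin₁₃ F N)).pinD189ΛH (Θ.liveRepin₁₃ F N).ν (Θ.liveRepin₁₃ F N).A₁ (Θ.liveRepin₁₃ F N).τ9.M (gOfRecord₁₃ F N (Θ.liveRepin₁₃ F N)) (fun P => (((((σ P).pinZres Θ.ν Θ.τ9.M (gOfRecord₁₃ F N (Θ.liveRepin₁₃ F N) P) (s P) (N0OfRecord₁₃ (Θ.liveRepin₁₃ F N) P (lam.kSel P + 1))).pinSides Θ.ν (gOfRecord₁₃ F N (Θ.liveRepin₁₃ F N) P) (lam.kSel P + 1 - Nm P) (lam.kSel P + 1)).pinXΩ4 (s P) (enlD F Θ.ν Θ.τ9.M P (gOfRecord₁₃ F N (Θ.liveRepin₁₃ F N) P))).pinOmegaPP (s P) (Nm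 P) (enlD F Θ.ν Θ.τ9.M P (gOfRecord₁₃ F N (Θ.liveRepin₁₃ F N) P)))) s Nm p₁).D189 P)
    (hmassLive : ∀ P : B12.RunParams, lam.kSel P < P.K → ∀ a, LiveSeq F N Θ.ν Θ.τ9 P (gOfRecord₁₃ F N (Θ.liveRepin₁₃ F N) P) (lam.kSel P + 1)
        (slotsTOfRecord F N Θ.ν Θ.τ9 (EOfRecord₁₃ F N (Θ.liveRepin₁₃ F N)) (wOfRecord₉ F N (Θ.liveRepin₁₃ F N).toStage9Params)
          (Θ.liveRepin₁₃ F N).ppSel P (gOfRecord₁₃ F N (Θ.liveRepin₁₃ F N) P) (lam.kSel P + 1)) a →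
      0 < ∫ V, rterm (reprTOfRecord₁₃ F N (Θ.liveRepin₁₃ F N) P (lam.kSel P)) a V ∂(fieldMeasure (F.P P.K) (lam.kSel P + 1) (SU N)))
    (hP1 : ∀ P : B12.RunParams, lam.kSel P < P.K → Prop1Printed (lam.LF P))
    (hlog : ∀ P : B12.RunParams, lam.kSel P < P.K → 1 < (Real.log (gOfRecord₁₃ F N (Θ.liveRepin₁₃ F N) P (lam.kSel P + 1) ^ 2)⁻¹) ^ Θ.ν.r)
    (hNN : ∀ P : B12.RunParams, lam.kSel P < P.K → N0OfRecord₁₃ (Θ.liveRepin₁₃ F N) P (lam.kSel P + 1) ≤ Nm P)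
    (hNk : ∀ P : B12.RunParams, lam.kSel P < P.K → N0OfRecord₁₃ (Θ.liveRepin₁₃ F N) P (lam.kSel P + 1) ≤ lam.kSel P + 1)
    (hβ0 : ∀ P : B12.RunParams, lam.kSel P < P.K → 0 ≤ (σ P).β)
    (hβ : ∀ P : B12.RunParams, lam.kSel P < P.K → (σ P).β ≤ 1 / 4)
    (hL₀ : ∀ P : B12.RunParams, lam.kSel P < P.K → 2 ≤ (σ P).L₀)
    (hL₀L : ∀ P : B12.RunParams, lam.kSel P < P.K → (σ P).L₀ ^ 2 ≤ ((F.P P.K).L : ℝ))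
    (hB : ∀ P : B12.RunParams, lam.kSel P < P.K → 0 ≤ (σ P).O1 * (σ P).B₃ * (σ P).B₅)
    (hδ : ∀ P : B12.RunParams, lam.kSel P < P.K → 0 ≤ (σ P).δ)
    (hN₀ : ∀ P : B12.RunParams, lam.kSel P < P.K → (2 + (121 / 120) ^ 2 * ((σ P).O1 * (σ P).B₃ * (σ P).B₅ * (Θ.τ9.M : ℝ) ^ 5)) *
      ((((σ P).L₀ ^ 2) ^ (N0OfRecord₁₃ (Θ.liveRepin₁₃ F N) P (lam.kSel P + 1) - 1))⁻¹) ≤ 1 / 4)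
    (hMl : ∀ P : B12.RunParams, lam.kSel P < P.K → (121 / 120) ^ 2 * ((σ P).O1 * (σ P).B₃ * (σ P).B₅ * (Θ.τ9.M : ℝ) ^ 5) * Real.exp (-(4 * (σ P).δ * (Θ.τ9.M : ℝ))) ≤ 1 / 12)
    (hε0 : ∀ P : B12.RunParams, lam.kSel P < P.K → ∀ i, lam.kSel P + 1 - Nm P ≤ i → i ≤ lam.kSel P + 1 → 0 ≤ epsOfRecord Θ.ν (gOfRecord₁₃ F N (Θ.liveRepin₁₃ F N) P) i)
    (hε1 : ∀ P : B12.RunParams, lam.kSel P < P.K → ∀ i, lam.kSel P + 1 - Nm P ≤ i → i ≤ lam.kSel P + 1 → epsOfRecord Θ.ν (gOfRecord₁₃ F N (Θ.liveRepin₁₃ F N) P) i ≤ 1 / 10)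
    {β₀ : ℝ}
    (hβ₀0 : 0 ≤ β₀)
    (hβ₀ : β₀ ≤ 1 / 2)
    (hflow : ∀ P : B12.RunParams, lam.kSel P < P.K → ∀ j, lam.kSel P + 1 - Nm P ≤ j → j < lam.kSel P + 1 → epsOfRecord Θ.ν (gOfRecord₁₃ F N (Θ.liveRepin₁₃ F N) P) (lam.kSel P + 1)
      ≤ (1 + β₀) * Real.sqrt ((lam.kSel P + 1 - j : ℕ) : ℝ) * epsOfRecord Θ.ν (gOfRecord₁₃ F N (Θ.liveRepin₁₃ F N) P) j)
    {b γ : ℝ}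
    (hb : 0 ≤ b)
    (hlow : BetaLowerH b γ (betaOfRecord₁₃ F N (Θ.liveRepin₁₃ F N)))
    (hγ1 : γ ≤ 1)
    (hI : ∀ P : B12.RunParams, lam.kSel P < P.K → Step.InInterval γ P.K (gOfRecord₁₃ F N (Θ.liveRepin₁₃ F N) P))
    (hΛ : ∀ P : B12.RunParams, lam.kSel P < P.K → (((enlD F Θ.ν Θ.τ9.M P (gOfRecord₁₃ F N (Θ.liveRepin₁₃ F N) P)) 4 (lam.kSel P + 1 + 1 - (N0OfRecord₁₃ (Θ.liveRepin₁₃ F N) P (lam.kSel P + 1)))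
        (omegaOfChain (s P) (lam.kSel P + 1 + 1 - (N0OfRecord₁₃ (Θ.liveRepin₁₃ F N) P (lam.kSel P + 1)))))ᶜ ∩ (σ P).Z).Nonempty)
    (L91h : ∀ P : B12.RunParams, lam.kSel P < P.K → ∀ U, new189 (D P) U → ∀ p ∈ plaqsOf (half (D P)),
      Ineq191 (dist1 (plaqHol ((D P).Upp U) p)) ((D P).devV'' U p) (D P).α (((D P).L ^ (D P).h)⁻¹) ((D P).ε (D P).h) (E124 (D P).ε (D P).L (D P).η (D P).k (D P).h))
    (L95 : ∀ P : B12.RunParams, lam.kSel P < P.K → ∀ U, new189 (D P) U → ∀ p ∈ plaqsOf (half (D P)),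
      Ineq195 ((D P).devV'' U p) (dist1 (plaqHol ((D P).Uhalf U ((D P).boxOf p)) p)) (D P).α (((D P).L ^ (D P).h)⁻¹) ((D P).ε (D P).h) (E124 (D P).ε (D P).L (D P).η (D P).k (D P).h))
    (L91 : ∀ P : B12.RunParams, lam.kSel P < P.K → ∀ U, new189 (D P) U → ∀ j, (D P).h ≤ j → j ≤ (D P).k → ∀ p ∈ plaqsOf (dom (D P) j),
      Ineq191 (dist1 (plaqHol ((D P).Upp U) p)) ((D P).dev97 U p) (D P).α (((D P).L ^ j)⁻¹) ((D P).ε j) (E124 (D P).ε (D P).L (D P).η (D P).k j))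
    (L97 : ∀ P : B12.RunParams, lam.kSel P < P.K → ∀ U, new189 (D P) U → ∀ j, (D P).h ≤ j → j ≤ (D P).k → ∀ p ∈ plaqsOf (dom (D P) j),
      Ineq191 ((D P).dev97 U p) ((D P).dev0 U p) (D P).α (((D P).L ^ j)⁻¹) ((D P).ε j) (E124 (D P).ε (D P).L (D P).η (D P).k j))
    (L80 : ∀ P : B12.RunParams, lam.kSel P < P.K → ∀ U, new189 (D P) U → ∀ j, (D P).h ≤ j → j ≤ (D P).k → ∀ p ∈ plaqsOf (dom (D P) j),
      Ineq180 ((D P).dev0 U p) ((D P).ε (D P).k) (D P).η (D P).B₃ (D P).B₅ (D P).M (D P).δ ((D P).dist p) (D P).O1)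
    (hsel : ∀ P : B12.RunParams, 1 ≤ P.K → lam.kSel P < P.K) :
    ∃ (θ' : Stage13HParams F N) (h' : θ'.Provisos₁₃SepCoPH F N) (w : WorldP), (θ'.ZhUnity F N ∧ θ'.SlotsNondegenerate₁₃ F N) ∧ θ'.Admissible F N ∧
      (∃ (θ'' : Stage13HParams F N) (h'' : θ''.Provisos₁₃SepCoPH F N), θ''.Admissible F N ∧
        datumOfRecord₁₃SepCoPH F N θ' h' = datumOfRecord₁₃SepCoPH F N θ'' h'' ∧ w.C = (datumOfRecord₁₃SepCoPH F N θ' h').C ∧ (0 < w.γ ∧ w.γ ≤ θ''.γ) ∧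
        w.L = (θ''.L : ℝ) ∧ ∀ P : B12.RunParams, w.up P = upOfRecord₅CS F N (θ''.toStage5₁₃CoPH F N) P) ∧
      (∀ P : B12.RunParams, Nodes (leavesP w P)) ∧ PrintedUV3V N θ'.L ∧
      ∃ lam : ResidW F N, (∀ P : B12.RunParams, 1 ≤ P.K → lam.kSel P < P.K) ∧
        ∀ P : B12.RunParams, lam.kSel P < P.K → ((leavesP w P).rBasicStep ↔ B15Leaf (WOfRecord₁₃ F N θ'.toStage13Params lam P)) := by
  have hn := nodes₁₃CoPH_upS_fourPinW₀_pointed (⟨⟨Θ.liveRepin₁₃ F N, Zr⟩, Zh, Phih⟩ : Stage13HParams F N) Mstar ops ζ W₀ w hP.toCore hθ.liveRepin₁₃ hC hγ hL hup h05S h06 h07 h08 h09 h09T h10 h11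
    (fun P => by
      by_cases hk : lam.kSel P < P.K
      · rw [hW P hk]
        exact N12AtRecord13TermPinnedZres.b15Leaf_WOfRecord₁₃_pinAllΛΩχZ_N0_liveRepin₁₃_of_massLive_of_hasResiduals_of_flow_of_betaLowerH Θ lam σ s Nm p₁ hres hk hM₂ hM (hD P) (hmassLive P hk) (hP1 P hk) (hlog P hk) (hNN P hk) (hNk P hk) (hβ0 P hk) (hβ P hk) (hL₀ P hk) (hL₀L P hk) (hB P hk) (hδ P hk) (hN₀ P hk) (hMl P hk) (hε0 P hk) (hε1 P hk) hβ₀0 hβ₀ (hflow P hk) hb hlow hγ1 (hI P hk) (hΛ P hk) (L91h P hk) (L95 P hk) (L91 P hk) (L97 P hk) (L80 P hk)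
      · exact hWdeg P (not_lt.1 hk))
    (fun P => laws₁₃CoPH_liveRepin₁₃_of_hasResiduals F N Θ Zr Zh Phih P hres hθ hκ hE₀ hB₀) hUV
  exact ⟨(⟨⟨Θ.liveRepin₁₃ F N, Zr⟩, Zh, Phih⟩ : Stage13HParams F N), hP, w, ⟨hZh, Stage13Params.slotsNondegenerate₁₃_liveRepin_of_hasResiduals hres⟩, hθ.liveRepin₁₃,
    recordS₁₃SepCoPH_of_upS_pinB10YZW₀ (⟨⟨Θ.liveRepin₁₃ F N, Zr⟩, Zh, Phih⟩ : Stage13HParams F N) Mstar ops ζ W₀ w hP hθ.liveRepin₁₃ hC hγ hL hup, hn, h08,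
    ((lam.pinRPrime₁₃ (Θ.liveRepin₁₃ F N)).pinD189ΛH (Θ.liveRepin₁₃ F N).ν (Θ.liveRepin₁₃ F N).A₁ (Θ.liveRepin₁₃ F N).τ9.M (gOfRecord₁₃ F N (Θ.liveRepin₁₃ F N))
        (fun P => (((((σ P).pinZres Θ.ν Θ.τ9.M (gOfRecord₁₃ F N (Θ.liveRepin₁₃ F N) P) (s P) (N0OfRecord₁₃ (Θ.liveRepin₁₃ F N) P (lam.kSel P + 1))).pinSides Θ.ν (gOfRecord₁₃ F N (Θ.liveRepin₁₃ F N) P) (lam.kSel P + 1 - Nm P) (lam.kSel P + 1)).pinXΩ4 (s P) (enlD F Θ.ν Θ.τ9.M P (gOfRecord₁₃ F N (Θ.liveRepin₁₃ F N) P))).pinOmegaPP (s P) (Nm P) (enlD F Θ.ν Θ.τ9.M P (gOfRecord₁₃ F N (Θ.liveRepin₁₃ F N) P)))) s Nm p₁), hsel, fun P hk => by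
      rw [← hW P hk]
      show (w.up P).rBasicStep ↔ _
      rw [hup P]
      exact Iff.rfl⟩

end Live

section Cured
variable (Θ : Stage13Params F N) (lam : ResidW F N) (σ : ∀ P : B12.RunParams, Sit189 F N P.K)
  (s : ∀ P : B12.RunParams, SeqOfRecord F Θ.ν Θ.τ9.M (gOfRecord₁₃ F N (Θ.liveRepin₁₃ F N) P) P.K (lam.kSel P + 1)) (Nm : B12.RunParams → ℕ) (p₁ : ℕ)
  (Mstar : ℕ) (ops : OpsY N (Θ.liveRepin₁₃ F N).toStage3Params Mstar) (ζ : ResidZ F N) (W₀ : B12.RunParams → PrintedCarriers15) (w : WorldP)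

/-- **★★ THE SAME AT THE DOOR-CURED PIN `Stage13HParams.ofHistoryBlind F N (Stage13RParams.ofCured F N (Θ.liveRepin₁₃ F N))`** — `ZhUnity` DISCHARGED (`(zrUnity_ofCured _).ofHistoryBlind`), K1⁷-side input = K1⁵'s `hP : (Θ.liveRepin₁₃).Provisos₁₃SepCoP` via `.ofCured.ofHistoryBlind`; the rung body ON THE K0⁷ → K1⁷ ROAD with N12 at the layer of record.  COMPOSITE: nothing discharged as a node. [cite: Balaban1989LargeFieldII, Thm 1 p.355, (0.1) pp.355–356, p.387, p.391; Balaban1989LargeFieldI, (0.1) p.175, (0.2)–(0.6) p.176, p.177 (i)–(ii), Prop. 1 (1.78) p.194, (1.80) p.195, (1.89) p.198, (1.99)–(1.102) pp.200–201; Balaban1988Convergent, (1.11) p.248, p.244, Thm 1 p.262, (2.18) p.257, (3.16)–(3.25) pp.268–270; Balaban1985RegularSpaces, Lemma 1 – Thm 8 pp.79–101, Thm 8 (1.146) p.101 (surviving form); Balaban1985UV3, Thm 1 p.257, Thm 2 p.272; Balaban1985BackgroundPropagators, Thm 3.1 p.397; Balaban1985Variational, Thm 1 p.279; Balaban1987RG1,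 Thm 1 p.259, Lemma 4 p.280; Balaban1988RG2Cluster, Lemmas 1–3 pp.9–20 (bookkeeping)] -/
theorem nodesAtSomeRecordS₁₃SepCoPH_of_upS_fourPinW₀_pinnedΛΩχZ_ofHistoryBlind_ofCured_liveRepin₁₃_of_massLive_of_hasResiduals (hres : Θ.HasResidualsOfRecord F N)
    (hP : (Θ.liveRepin₁₃ F N).Provisos₁₃SepCoP F N) (hθ : Θ.Admissible F N)
    (hκ : 0 ≤ Θ.s2.lf.κ) (hE₀ : 0 ≤ Θ.s2.lf.E₀) (hB₀ : 0 ≤ Θ.s2.lf.B₀)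
    -- the mixed W-pin AT THE LAYER OF RECORD λᴾ: below the torus `W₀ P` IS the bundle of record at λᴾ; elsewhere the closer's leaf-carrying `W₀ P`
    (hW : ∀ P : B12.RunParams, lam.kSel P < P.K → W₀ P = WOfRecord₁₃ F N (Θ.liveRepin₁₃ F N)
      ((lam.pinRPrime₁₃ (Θ.liveRepin₁₃ F N)).pinD189ΛH (Θ.liveRepin₁₃ F N).ν (Θ.liveRepin₁₃ F N).A₁ (Θ.liveRepin₁₃ F N).τ9.M (gOfRecord₁₃ F N (Θ.liveRepin₁₃ F N))
        (fun P => (((((σ P).pinZres Θ.ν Θ.τ9.M (gOfRecord₁₃ F N (Θ.liveRepin₁₃ F N) P) (s P) (N0OfRecord₁₃ (Θ.liveRepin₁₃ F N) P (lam.kSel P + 1))).pinSides Θ.ν (gOfRecord₁₃ F N (Θ.liveRepin₁₃ F N) P) (lam.kSel P + 1 - Nm P) (lam.kSel P + 1)).pinXΩ4 (s P) (enlD F Θ.ν Θ.τ9.M P (gOfRecord₁₃ F N (Θ.liveRepin₁₃ F N) P))).pinOmegaPP (s P) (Nm P) (enlD F Θ.ν Θ.τ9.M P (gOfRecord₁₃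 F N (Θ.liveRepin₁₃ F N) P)))) s Nm p₁) P)
    (hWdeg : ∀ P : B12.RunParams, P.K ≤ lam.kSel P → B15Leaf (W₀ P))
    (hC : w.C = (datumOfRecord₁₃SepCoPH F N (Stage13HParams.ofHistoryBlind F N (Stage13RParams.ofCured F N (Θ.liveRepin₁₃ F N))) hP.ofCured.ofHistoryBlind).C) (hγ : 0 < w.γ ∧ w.γ ≤ (Θ.liveRepin₁₃ F N).γ) (hL : w.L = ((Θ.liveRepin₁₃ F N).L : ℝ))
    (hup : ∀ P, w.up P = upOfRecord₅CS F N ((((((Stage13HParams.ofHistoryBlind F N (Stage13RParams.ofCured F N (Θ.liveRepin₁₃ F N))).toStage5₁₃CoPH F N).pinB10 F N).pinY F N (Y9OfRecord N (Θ.liveRepin₁₃ F N).toStage3Params Mstar ops)).pinZ F N (Z11OfRecord F N ζ)).pinW F N W₀) P)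
    (h05S : ∀ P : B12.RunParams, (upOfRecord₅CS F N ((((((Stage13HParams.ofHistoryBlind F N (Stage13RParams.ofCured F N (Θ.liveRepin₁₃ F N))).toStage5₁₃CoPH F N).pinB10 F N).pinY F N (Y9OfRecord N (Θ.liveRepin₁₃ F N).toStage3Params Mstar ops)).pinZ F N (Z11OfRecord F N ζ)).pinW F N W₀) P).b8)
    (h06 : B9LeafX (Y9OfRecord N (Θ.liveRepin₁₃ F N).toStage3Params Mstar ops))
    (h07 : B11Leaf (Z11OfRecord F N ζ))
    (h08 : PrintedUV3V N (Θ.liveRepin₁₃ F N).L)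
    (h09 : ∀ P : B12.RunParams, B12Sec2to5.Lemma4Printed ((Θ.liveRepin₁₃ F N).res.X P).F12 ((Θ.liveRepin₁₃ F N).res.X P).c12)
    (h09T : ∀ P : B12.RunParams, (leavesP w P).smallCouplings → (leavesP w P).smallFieldInductive)
    (h10 : ∀ P : B12.RunParams, B9LeafX (Y9OfRecord N (Θ.liveRepin₁₃ F N).toStage3Params Mstar ops) →
      (B10.Thm1PrintedCompact (((((((Stage13HParams.ofHistoryBlind F N (Stage13RParams.ofCured F N (Θ.liveRepin₁₃ F N))).toStage5₁₃CoPH F N).pinB10 F N).pinY F N (Y9OfRecord N (Θ.liveRepin₁₃ F N).toStage3Params Mstar ops)).pinZ F N (Z11OfRecord F N ζ)).pinW F N W₀).res.X P).runs10 ∧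
          B10.Thm2Printed (((((((Stage13HParams.ofHistoryBlind F N (Stage13RParams.ofCured F N (Θ.liveRepin₁₃ F N))).toStage5₁₃CoPH F N).pinB10 F N).pinY F N (Y9OfRecord N (Θ.liveRepin₁₃ F N).toStage3Params Mstar ops)).pinZ F N (Z11OfRecord F N ζ)).pinW F N W₀).res.X P).runs10) →
        B11Leaf (Z11OfRecord F N ζ) → B12Sec2to5.Lemma4Printed ((Θ.liveRepin₁₃ F N).res.X P).F12 ((Θ.liveRepin₁₃ F N).res.X P).c12 →
          B13.Lemma1Printed ((Θ.liveRepin₁₃ F N).res.X P).S13 ((Θ.liveRepin₁₃ F N).res.X P).c13 ∧ B13.Lemma2Printed ((Θ.liveRepin₁₃ F N).res.X P).S13 ((Θ.liveRepin₁₃ F N).res.X P).c13 ∧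
            B13.Lemma3Printed ((Θ.liveRepin₁₃ F N).res.X P).S13 ((Θ.liveRepin₁₃ F N).res.X P).c13)
    (h11 : ∀ P : B12.RunParams, (leavesP w P).b7 → (leavesP w P).b8 → (leavesP w P).b9 → (leavesP w P).b10 → (leavesP w P).b11 →
      (leavesP w P).smallCouplings → (leavesP w P).smallFieldInductive → (leavesP w P).flowControl →
        ∀ k, k < P.K → SLaw₁₃CoPH F N (Stage13HParams.ofHistoryBlind F N (Stage13RParams.ofCured F N (Θ.liveRepin₁₃ F N))) P k → TLaw₁₃CoPH F N (Stage13HParams.ofHistoryBlind F N (Stage13RParams.ofCured F N (Θ.liveRepin₁₃ F N))) P k)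
    (hUV : ∀ P : B12.RunParams, (genFlow (betaOfRecord₁₃ F N (Θ.liveRepin₁₃ F N)) P.g0).InInterval w.γ P.K → ∀ k, k ≤ P.K → SLaw₁₃CoPH F N (Stage13HParams.ofHistoryBlind F N (Stage13RParams.ofCured F N (Θ.liveRepin₁₃ F N))) P k →
      ∀ U : GaugeField (F.P P.K) k (SU N),
        chiβOfRecord₁₃ F N (Θ.liveRepin₁₃ F N) P.K (gOfRecord₁₃ F N (Θ.liveRepin₁₃ F N) P) k U *
              Real.exp (-(1 / (gOfRecord₁₃ F N (Θ.liveRepin₁₃ F N) P k) ^ 2 * wilsonBGOfRecord F N (Θ.liveRepin₁₃ F N).εbg P k U)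
                - w.em (gOfRecord₁₃ F N (Θ.liveRepin₁₃ F N) P k) * (Fintype.card (Site (F.P P.K) k) : ℝ)) ≤ densOfRecord₁₃ F N (Θ.liveRepin₁₃ F N) P k U ∧
        densOfRecord₁₃ F N (Θ.liveRepin₁₃ F N) P k U ≤ Real.exp (w.ep (gOfRecord₁₃ F N (Θ.liveRepin₁₃ F N) P k) * (Fintype.card (Site (F.P P.K) k) : ℝ)))
    -- N12 AT THE LAYER OF RECORD: 12P's located per-run inputs, run by run, BELOW THE TORUS ONLY (`D P` abbreviates the pinned (1.89) setting `λᴾ.D189 P`)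
    (hM₂ : 0 < Θ.ν.M₂)
    (hM : 0 < Θ.τ9.M)
    (D : ∀ P : B12.RunParams, Setting189 (F.P P.K) (SU N) (MSField (F.P P.K) (SU N) × ((j : ℕ) → VecField (F.P P.K) j (EuclideanSpace ℝ (Fin (N ^ 2 - 1))))) (Pt (F.P P.K).d))
    (hD : ∀ P : B12.RunParams, D P = ((lam.pinRPrime₁₃ (Θ.liveRepin₁₃ F N)).pinD189ΛH (Θ.liveRepin₁₃ F N).ν (Θ.liveRepin₁₃ F N).A₁ (Θ.liveRepin₁₃ F N).τ9.M (gOfRecord₁₃ F N (Θ.liveRepin₁₃ F N)) (fun P => (((((σ P).pinZres Θ.ν Θ.τ9.M (gOfRecord₁₃ F N (Θ.liveRepin₁₃ F N) P) (s P) (N0OfRecord₁₃ (Θ.liveRepin₁₃ F N) P (lam.kSel P + 1))).pinSides Θ.ν (gOfRecord₁₃ F N (Θ.liveRepin₁₃ F N) P) (lam.kSel P + 1 - Nm P) (lam.kSel P + 1)).pinXΩ4 (s P) (enlD F Θ.ν Θ.τ9.M P (gOfRecord₁₃ F N (Θ.liveRepin₁₃ F N) P))).pinOmegaPP (s P) (Nm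 P) (enlD F Θ.ν Θ.τ9.M P (gOfRecord₁₃ F N (Θ.liveRepin₁₃ F N) P)))) s Nm p₁).D189 P)
    (hmassLive : ∀ P : B12.RunParams, lam.kSel P < P.K → ∀ a, LiveSeq F N Θ.ν Θ.τ9 P (gOfRecord₁₃ F N (Θ.liveRepin₁₃ F N) P) (lam.kSel P + 1)
        (slotsTOfRecord F N Θ.ν Θ.τ9 (EOfRecord₁₃ F N (Θ.liveRepin₁₃ F N)) (wOfRecord₉ F N (Θ.liveRepin₁₃ F N).toStage9Params)
          (Θ.liveRepin₁₃ F N).ppSel P (gOfRecord₁₃ F N (Θ.liveRepin₁₃ F N) P) (lam.kSel P + 1)) a →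
      0 < ∫ V, rterm (reprTOfRecord₁₃ F N (Θ.liveRepin₁₃ F N) P (lam.kSel P)) a V ∂(fieldMeasure (F.P P.K) (lam.kSel P + 1) (SU N)))
    (hP1 : ∀ P : B12.RunParams, lam.kSel P < P.K → Prop1Printed (lam.LF P))
    (hlog : ∀ P : B12.RunParams, lam.kSel P < P.K → 1 < (Real.log (gOfRecord₁₃ F N (Θ.liveRepin₁₃ F N) P (lam.kSel P + 1) ^ 2)⁻¹) ^ Θ.ν.r)
    (hNN : ∀ P : B12.RunParams, lam.kSel P < P.K → N0OfRecord₁₃ (Θ.liveRepin₁₃ F N) P (lam.kSel P + 1) ≤ Nm P)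
    (hNk : ∀ P : B12.RunParams, lam.kSel P < P.K → N0OfRecord₁₃ (Θ.liveRepin₁₃ F N) P (lam.kSel P + 1) ≤ lam.kSel P + 1)
    (hβ0 : ∀ P : B12.RunParams, lam.kSel P < P.K → 0 ≤ (σ P).β)
    (hβ : ∀ P : B12.RunParams, lam.kSel P < P.K → (σ P).β ≤ 1 / 4)
    (hL₀ : ∀ P : B12.RunParams, lam.kSel P < P.K → 2 ≤ (σ P).L₀)
    (hL₀L : ∀ P : B12.RunParams, lam.kSel P < P.K → (σ P).L₀ ^ 2 ≤ ((F.P P.K).L : ℝ))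
    (hB : ∀ P : B12.RunParams, lam.kSel P < P.K → 0 ≤ (σ P).O1 * (σ P).B₃ * (σ P).B₅)
    (hδ : ∀ P : B12.RunParams, lam.kSel P < P.K → 0 ≤ (σ P).δ)
    (hN₀ : ∀ P : B12.RunParams, lam.kSel P < P.K → (2 + (121 / 120) ^ 2 * ((σ P).O1 * (σ P).B₃ * (σ P).B₅ * (Θ.τ9.M : ℝ) ^ 5)) *
      ((((σ P).L₀ ^ 2) ^ (N0OfRecord₁₃ (Θ.liveRepin₁₃ F N) P (lam.kSel P + 1) - 1))⁻¹) ≤ 1 / 4)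
    (hMl : ∀ P : B12.RunParams, lam.kSel P < P.K → (121 / 120) ^ 2 * ((σ P).O1 * (σ P).B₃ * (σ P).B₅ * (Θ.τ9.M : ℝ) ^ 5) * Real.exp (-(4 * (σ P).δ * (Θ.τ9.M : ℝ))) ≤ 1 / 12)
    (hε0 : ∀ P : B12.RunParams, lam.kSel P < P.K → ∀ i, lam.kSel P + 1 - Nm P ≤ i → i ≤ lam.kSel P + 1 → 0 ≤ epsOfRecord Θ.ν (gOfRecord₁₃ F N (Θ.liveRepin₁₃ F N) P) i)
    (hε1 : ∀ P : B12.RunParams, lam.kSel P < P.K → ∀ i, lam.kSel P + 1 - Nm P ≤ i → i ≤ lam.kSel P + 1 → epsOfRecord Θ.ν (gOfRecord₁₃ F N (Θ.liveRepin₁₃ F N) P) i ≤ 1 / 10)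
    {β₀ : ℝ}
    (hβ₀0 : 0 ≤ β₀)
    (hβ₀ : β₀ ≤ 1 / 2)
    (hflow : ∀ P : B12.RunParams, lam.kSel P < P.K → ∀ j, lam.kSel P + 1 - Nm P ≤ j → j < lam.kSel P + 1 → epsOfRecord Θ.ν (gOfRecord₁₃ F N (Θ.liveRepin₁₃ F N) P) (lam.kSel P + 1)
      ≤ (1 + β₀) * Real.sqrt ((lam.kSel P + 1 - j : ℕ) : ℝ) * epsOfRecord Θ.ν (gOfRecord₁₃ F N (Θ.liveRepin₁₃ F N) P) j)
    {b γ : ℝ}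
    (hb : 0 ≤ b)
    (hlow : BetaLowerH b γ (betaOfRecord₁₃ F N (Θ.liveRepin₁₃ F N)))
    (hγ1 : γ ≤ 1)
    (hI : ∀ P : B12.RunParams, lam.kSel P < P.K → Step.InInterval γ P.K (gOfRecord₁₃ F N (Θ.liveRepin₁₃ F N) P))
    (hΛ : ∀ P : B12.RunParams, lam.kSel P < P.K → (((enlD F Θ.ν Θ.τ9.M P (gOfRecord₁₃ F N (Θ.liveRepin₁₃ F N) P)) 4 (lam.kSel P + 1 + 1 - (N0OfRecord₁₃ (Θ.liveRepin₁₃ F N) P (lam.kSel P + 1)))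
        (omegaOfChain (s P) (lam.kSel P + 1 + 1 - (N0OfRecord₁₃ (Θ.liveRepin₁₃ F N) P (lam.kSel P + 1)))))ᶜ ∩ (σ P).Z).Nonempty)
    (L91h : ∀ P : B12.RunParams, lam.kSel P < P.K → ∀ U, new189 (D P) U → ∀ p ∈ plaqsOf (half (D P)),
      Ineq191 (dist1 (plaqHol ((D P).Upp U) p)) ((D P).devV'' U p) (D P).α (((D P).L ^ (D P).h)⁻¹) ((D P).ε (D P).h) (E124 (D P).ε (D P).L (D P).η (D P).k (D P).h))
    (L95 : ∀ P : B12.RunParams, lam.kSel P < P.K → ∀ U, new189 (D P) U → ∀ p ∈ plaqsOf (half (D P)),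
      Ineq195 ((D P).devV'' U p) (dist1 (plaqHol ((D P).Uhalf U ((D P).boxOf p)) p)) (D P).α (((D P).L ^ (D P).h)⁻¹) ((D P).ε (D P).h) (E124 (D P).ε (D P).L (D P).η (D P).k (D P).h))
    (L91 : ∀ P : B12.RunParams, lam.kSel P < P.K → ∀ U, new189 (D P) U → ∀ j, (D P).h ≤ j → j ≤ (D P).k → ∀ p ∈ plaqsOf (dom (D P) j),
      Ineq191 (dist1 (plaqHol ((D P).Upp U) p)) ((D P).dev97 U p) (D P).α (((D P).L ^ j)⁻¹) ((D P).ε j) (E124 (D P).ε (D P).L (D P).η (D P).k j))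
    (L97 : ∀ P : B12.RunParams, lam.kSel P < P.K → ∀ U, new189 (D P) U → ∀ j, (D P).h ≤ j → j ≤ (D P).k → ∀ p ∈ plaqsOf (dom (D P) j),
      Ineq191 ((D P).dev97 U p) ((D P).dev0 U p) (D P).α (((D P).L ^ j)⁻¹) ((D P).ε j) (E124 (D P).ε (D P).L (D P).η (D P).k j))
    (L80 : ∀ P : B12.RunParams, lam.kSel P < P.K → ∀ U, new189 (D P) U → ∀ j, (D P).h ≤ j → j ≤ (D P).k → ∀ p ∈ plaqsOf (dom (D P) j),
      Ineq180 ((D P).dev0 U p) ((D P).ε (D P).k) (D P).η (D P).B₃ (D P).B₅ (D P).M (D P).δ ((D P).dist p) (D P).O1)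
    (hsel : ∀ P : B12.RunParams, 1 ≤ P.K → lam.kSel P < P.K) :
    ∃ (θ' : Stage13HParams F N) (h' : θ'.Provisos₁₃SepCoPH F N) (w : WorldP), (θ'.ZhUnity F N ∧ θ'.SlotsNondegenerate₁₃ F N) ∧ θ'.Admissible F N ∧
      (∃ (θ'' : Stage13HParams F N) (h'' : θ''.Provisos₁₃SepCoPH F N), θ''.Admissible F N ∧
        datumOfRecord₁₃SepCoPH F N θ' h' = datumOfRecord₁₃SepCoPH F N θ'' h'' ∧ w.C = (datumOfRecord₁₃SepCoPH F N θ' h').C ∧ (0 < w.γ ∧ w.γ ≤ θ''.γ) ∧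
        w.L = (θ''.L : ℝ) ∧ ∀ P : B12.RunParams, w.up P = upOfRecord₅CS F N (θ''.toStage5₁₃CoPH F N) P) ∧
      (∀ P : B12.RunParams, Nodes (leavesP w P)) ∧ PrintedUV3V N θ'.L ∧
      ∃ lam : ResidW F N, (∀ P : B12.RunParams, 1 ≤ P.K → lam.kSel P < P.K) ∧
        ∀ P : B12.RunParams, lam.kSel P < P.K → ((leavesP w P).rBasicStep ↔ B15Leaf (WOfRecord₁₃ F N θ'.toStage13Params lam P)) :=
  nodesAtSomeRecordS₁₃SepCoPH_of_upS_fourPinW₀_pinnedΛΩχZ_liveRepin₁₃H_of_massLive_of_hasResiduals Θ (ZrOfRecord₁₃ F N (Θ.liveRepin₁₃ F N)) (fun p _ _ _ => (Stage13RParams.ofCured F N (Θ.liveRepin₁₃ F N)).Zr p)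
    (fun p _ _ _ => ((Stage13RParams.ofCured F N (Θ.liveRepin₁₃ F N)).Rz p.K).phi) lam σ s Nm p₁ Mstar ops ζ W₀ w hres hP.ofCured.ofHistoryBlind hθ (Stage13RParams.zrUnity_ofCured (Θ.liveRepin₁₃ F N)).ofHistoryBlind
    hκ hE₀ hB₀ hW hWdeg hC hγ hL hup h05S h06 h07 h08 h09 h09T h10 h11 hUV
    hM₂ hM D hD hmassLive hP1 hlog hNN hNk hβ0 hβ hL₀ hL₀L hB hδ hN₀ hMl hε0 hε1 hβ₀0 hβ₀ hflow hb hlow hγ1 hI hΛ L91h L95 L91 L97 L80 hsel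

end Cured

end Summit.QuantumFields.YangMills.BalabanUVNodes.N12AtRecord13SepCoPHSocketsPinned
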